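import Mathlib
import Summits.NavierStokesRegularity.NavierStokesRegularity.Theorems.SubOnsagerCeilingVirtualFloorKernelFaceAffine
import Summits.NavierStokesRegularity.NavierStokesRegularity.Theorems.SubOnsagerCeilingGapKernel
import HarnessLib

/-!
# From kernel certificates to the `hFace` hypotheses of the face family «d45» (generic bridge)
(helper file for crux stmt-NavierStokesRegularity-27057 `SubOnsagerCeiling.ForwardTailCeilingKP`, `--supports … --as helper`;
LEAD SOC g11, line «kp-shell-barrier», RUNG 10 = the chain ceiling on `b ∈ [3/2, 25/16]`)

Two generic lemmas, used once per face and slice by the slice assembly files: an accepted kd-tree certificate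
(`KernelFaceAffine.leafCheckAff`, p699455) for the substituted inertial expression `substVar (sElim k) (qElim k) (eBase k)` of face `k`
of the family «d45» (`SubOnsagerCeilingGapFaces` / `SubOnsagerCeilingGapKernel`) under the slacks
`gsBase.map (substVar …) ++ [qElim k, 49/50 − qElim k]` on a box `B` gives, at every state whose evaluation point lies in `B`, whose
three windows lie in `Ω` and which lies ON the face, `(eBase k).eval pt < 0` (`inertial_of_cert`); the damping analogue gives
`0 ≤ (dBase k).eval pt` (`damping_of_cert`). With `eval_eBase` / `eval_dBase` these are literally the two conjuncts of the `hFace`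
hypothesis of `VirtualFloor.chain_le_of_coupledFaceCertB` (p689309); `inertial_real_of_eval` rewrites the first into the real form.
HONEST FRAMING: MODEL-lattice plumbing (route SubOnsagerCeiling, TL-M2Break); nothing here bears on Navier–Stokes regularity;
27057 stays OPEN. [cite: FigueiredoStolfi2004, §3] [cite: BarbatoMorandinRomito2011, §2 Lemma 2.1]
-/

noncomputable section

-- the sub-problem namespace `NavierStokesRegularity.NavierStokesRegularity` is the tree's layout (D-0017)
set_option linter.dupNamespace false

namespace Summit.NavierStokesRegularity.NavierStokesRegularity.Theorems.VirtualFloor.GapRung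

open Literature.Analysis.ValidatedNumerics KernelFaceMul KernelFaceAffine
open Summit.NavierStokesRegularity.NavierStokesRegularity.Theorems.VirtualFloor

/-- **Inertial face condition from a kernel certificate.** [cite: FigueiredoStolfi2004, §3] -/
theorem inertial_of_cert {k : Ix} {t : KdCert LeafMul} {B : Box}
    (hcert : t.check (leafCheckAff (substVar (sElim k) (qElim k) (eBase k))
      (gsBase.map (substVar (sElim k) (qElim k)) ++ [qElim k, .sub (.const (49 / 50)) (qElim k)]) (-(1 / 256))) B = true)
    {x : Fin 4 → ℝ} {v z L p b2 : ℝ} (hmem : Box.mem B (pt x v z L p b2))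
    (h0 : ∀ i, 0 ≤ x i) (hc : ∀ i, x i ≤ (49 / 50 : ℝ))
    (hX : ∀ j, face j x ≤ 0) (hLo : ∀ j, face j (vec4 v (x 0) (x 1) (x 2)) ≤ 0)
    (hUp : ∀ j, face j (vec4 (x 1) (x 2) (x 3) z) ≤ 0) (hk : face k x = 0) :
    (eBase k).eval (pt x v z L p b2) < 0 :=
  eval_lt_zero_of_kdCheckAff_subst (by norm_num) hcert _ hmem (pt_sElim_eq x v z L p b2 k hk)
    (gsBase_nonneg x v z L p b2 hX hLo hUp) (extra_nonneg x v z L p b2 k hk h0 hc)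

/-- **Damping sign condition from a kernel certificate.** [cite: FigueiredoStolfi2004, §3] -/
theorem damping_of_cert {k : Ix} {t : KdCert LeafMul} {B : Box}
    (hcert : t.check (leafCheckAff (.neg (substVar (sElim k) (qElim k) (dBase k)))
      (gsBase.map (substVar (sElim k) (qElim k)) ++ [qElim k, .sub (.const (49 / 50)) (qElim k)]) 0) B = true)
    {x : Fin 4 → ℝ} {v z L p b2 : ℝ} (hmem : Box.mem B (pt x v z L p b2))
    (h0 : ∀ i, 0 ≤ x i) (hc : ∀ i, x i ≤ (49 / 50 : ℝ))
    (hX : ∀ j, face j x ≤ 0) (hLo : ∀ j, face j (vec4 v (x 0) (x 1) (x 2)) ≤ 0)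
    (hUp : ∀ j, face j (vec4 (x 1) (x 2) (x 3) z) ≤ 0) (hk : face k x = 0) :
    0 ≤ faceGrad k 0 x * x 0 + faceGrad k 1 x * (b2 * x 1) + faceGrad k 2 x * (b2 ^ 2 * x 2) +
      faceGrad k 3 x * (b2 ^ 3 * x 3) := by
  rw [← eval_dBase x v z L p b2 k]
  exact eval_nonneg_of_kdCheckAff_subst hcert _ hmem (pt_sElim_eq x v z L p b2 k hk)
    (gsBase_nonneg x v z L p b2 hX hLo hUp) (extra_nonneg x v z L p b2 k hk h0 hc)

/-- The inertial conclusion in the real form of `hFace` (via `eval_eBase`). [folklore] -/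
theorem inertial_real_of_eval {k : Ix} {x : Fin 4 → ℝ} {v z L p b2 : ℝ}
    (h : (eBase k).eval (pt x v z L p b2) < 0) :
    faceGrad k 0 x * (v ^ 2 - p * x 0 * x 1) + faceGrad k 1 x * (L * (x 0 ^ 2 - p * x 1 * x 2)) +
      faceGrad k 2 x * (L ^ 2 * (x 1 ^ 2 - p * x 2 * x 3)) + faceGrad k 3 x * (L ^ 3 * (x 2 ^ 2 - p * x 3 * z)) < 0 := by
  rwa [eval_eBase] at h

end Summit.NavierStokesRegularity.NavierStokesRegularity.Theorems.VirtualFloor.GapRung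

end
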